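import Mathlib

/-!
# Crux `ArithStatLadder.IqThreeNotPPoly` (stmt-QuantumAdvantage-2422)

Stub `stub_apSieve` of the line `Sketch`: the ELEMENTARY SQUAREFREE SIEVE IN AN ARITHMETIC
PROGRESSION with explicit constants (Mathlib only).

If `gcd(a, q) = 1`, `0 < q`, and every prime NOT dividing `q` is at least `p₀ ≥ 2`, then
`#{k < K : a + q k not squarefree} ≤ K / (p₀ - 1) + √(a + q K)`, stated multiplied through by
`p₀ - 1` and with `Nat.sqrt`.

Proof. For `a = 0` coprimality forces `q = 1`, hence `p₀ = 2`, and the bound is the trivial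
`#bad ≤ K`. For `a ≥ 1`: a non-squarefree `a + q k` has a prime `p` with `p² ∣ a + q k`; such a
`p` is coprime to `q` (else `p ∣ gcd(a, q) = 1`), so `p₀ ≤ p`, and `p² ≤ a + q k ≤ a + q K` gives
`p ≤ S := Nat.sqrt (a + q K)`. For a modulus `n` coprime to `q` the set `{k < K : n ∣ a + q k}`
lies in one residue class mod `n`, so it has at most `K / n + 1` elements (inject `k ↦ k / n` into
`range (K / n + 1)`). The union bound over `m ∈ [p₀, S]` coprime to `q` gives
`#bad ≤ Σ_m (K / m² + 1)`, and `(p₀ - 1) Σ_{m = p₀}^{S} K / m² ≤ (p₀ - 1) K Σ 1/(m(m-1))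
= (p₀ - 1) K (1/(p₀-1) - 1/S) ≤ K` (telescoping, done in `ℚ`), while the number of moduli is
`≤ #[p₀, S] ≤ S`.
-/

set_option linter.dupNamespace false -- D-0017: single-problem summit ⇒ `QuantumAdvantage.QuantumAdvantage` by design

namespace Summit.QuantumAdvantage.QuantumAdvantage.Theorems.IqThreeNotPPoly

open scoped Classical
open Finset

/-- One residue class: if `n > 0` is coprime to `q`, the `k < K` with `n ∣ a + q k` are pairwise
congruent mod `n`, hence there are at most `K / n + 1` of them. -/
theorem apSieve_card_filter_dvd_le (a q K n : ℕ) (hcop : Nat.Coprime n q) :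
    ((Finset.range K).filter (fun k => n ∣ a + q * k)).card ≤ K / n + 1 := by
  set B := (Finset.range K).filter (fun k => n ∣ a + q * k) with hB
  have hmod : ∀ k₁ ∈ B, ∀ k₂ ∈ B, k₁ % n = k₂ % n := by
    intro k₁ hk₁ k₂ hk₂
    rw [hB, Finset.mem_filter] at hk₁ hk₂
    have h3 : a + q * k₁ ≡ a + q * k₂ [MOD n] :=
      (Nat.modEq_zero_iff_dvd.mpr hk₁.2).trans (Nat.modEq_zero_iff_dvd.mpr hk₂.2).symm
    exact Nat.ModEq.cancel_left_of_coprime hcop (Nat.ModEq.add_left_cancel' a h3)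
  have hmaps : ∀ k ∈ B, k / n ∈ Finset.range (K / n + 1) := by
    intro k hk
    rw [hB, Finset.mem_filter, Finset.mem_range] at hk
    exact Finset.mem_range.mpr (Nat.lt_succ_of_le (Nat.div_le_div_right hk.1.le))
  have hinj : Set.InjOn (fun k => k / n) ↑B := by
    intro k₁ hk₁ k₂ hk₂ heq
    have hr := hmod k₁ hk₁ k₂ hk₂
    have heq' : k₁ / n = k₂ / n := heq
    calc k₁ = n * (k₁ / n) + k₁ % n := (Nat.div_add_mod k₁ n).symm
      _ = n * (k₂ / n) + k₂ % n := by rw [heq', hr]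
      _ = k₂ := Nat.div_add_mod k₂ n
  have hcc := Finset.card_le_card_of_injOn _ hmaps hinj
  simpa using hcc

/-- Telescoping closed form: for `2 ≤ p₀ ≤ S + 1`,
`Σ_{m = p₀}^{S} 1/(m(m-1)) = 1/(p₀-1) - 1/S` in `ℚ`. -/
theorem apSieve_telescope (p₀ : ℕ) (hp₀ : 2 ≤ p₀) :
    ∀ S : ℕ, p₀ ≤ S + 1 →
      ∑ m ∈ Finset.Icc p₀ S, (1 : ℚ) / ((m : ℚ) * ((m : ℚ) - 1)) =
        1 / ((p₀ : ℚ) - 1) - 1 / (S : ℚ) := by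
  intro S
  induction S with
  | zero => intro h; omega
  | succ S ih =>
    intro h
    rcases Nat.lt_or_ge (S + 1) p₀ with hlt | hge
    · have hp : p₀ = S + 2 := by omega
      subst hp
      rw [Finset.Icc_eq_empty_of_lt (by omega), Finset.sum_empty]
      push_cast
      ring
    · rw [Finset.sum_Icc_succ_top (by omega : p₀ ≤ S + 1), ih hge]
      have hS0 : (S : ℚ) ≠ 0 := by
        have : (1 : ℚ) ≤ S := by exact_mod_cast (by omega : 1 ≤ S)
        positivity
      have hS1 : (S : ℚ) + 1 ≠ 0 := by positivity
      have hp1 : (p₀ : ℚ) - 1 ≠ 0 := by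
        have : (2 : ℚ) ≤ p₀ := by exact_mod_cast hp₀
        linarith
      push_cast
      rw [add_sub_cancel_right]
      field_simp
      ring

/-- The telescoping bound: `Σ_{m = p₀}^{S} 1/(m(m-1)) ≤ 1/(p₀-1)` in `ℚ` for `2 ≤ p₀`. -/
theorem apSieve_sum_le (p₀ S : ℕ) (hp₀ : 2 ≤ p₀) :
    ∑ m ∈ Finset.Icc p₀ S, (1 : ℚ) / ((m : ℚ) * ((m : ℚ) - 1)) ≤ 1 / ((p₀ : ℚ) - 1) := by
  rcases Nat.lt_or_ge (S + 1) p₀ with h | h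
  · rw [Finset.Icc_eq_empty_of_lt (by omega), Finset.sum_empty]
    have : (2 : ℚ) ≤ p₀ := by exact_mod_cast hp₀
    have : (0 : ℚ) < (p₀ : ℚ) - 1 := by linarith
    positivity
  · rw [apSieve_telescope p₀ hp₀ S h]
    have : (0 : ℚ) ≤ 1 / (S : ℚ) := by positivity
    linarith

/-- The arithmetic heart: `(p₀ - 1) * Σ_{m ∈ P} K / m² ≤ K` for any `P ⊆ [p₀, S]`, `2 ≤ p₀`
(floor divisions in `ℕ`, proved through `ℚ`). -/
theorem apSieve_mul_sum_div_le (p₀ S K : ℕ) (hp₀ : 2 ≤ p₀) (P : Finset ℕ)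
    (hP : P ⊆ Finset.Icc p₀ S) :
    (p₀ - 1) * ∑ m ∈ P, K / (m * m) ≤ K := by
  have hp2 : (2 : ℚ) ≤ p₀ := by exact_mod_cast hp₀
  have hm2 : ∀ m ∈ Finset.Icc p₀ S, (2 : ℚ) ≤ m := by
    intro m hm
    exact_mod_cast le_trans hp₀ (Finset.mem_Icc.mp hm).1
  have key : ((∑ m ∈ P, K / (m * m) : ℕ) : ℚ) ≤ (K : ℚ) / ((p₀ : ℚ) - 1) := by
    push_cast
    calc ∑ m ∈ P, ((K / (m * m) : ℕ) : ℚ)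
        ≤ ∑ m ∈ P, (K : ℚ) * (1 / ((m : ℚ) * ((m : ℚ) - 1))) := by
          refine Finset.sum_le_sum fun m hm => ?_
          have h2 := hm2 m (hP hm)
          calc ((K / (m * m) : ℕ) : ℚ) ≤ (K : ℚ) / ((m * m : ℕ) : ℚ) := Nat.cast_div_le
            _ ≤ (K : ℚ) / ((m : ℚ) * ((m : ℚ) - 1)) := by
                push_cast
                exact div_le_div_of_nonneg_left (by positivity) (by nlinarith) (by nlinarith)
            _ = (K : ℚ) * (1 / ((m : ℚ) * ((m : ℚ) - 1))) := by ring
      _ ≤ ∑ m ∈ Finset.Icc p₀ S, (K : ℚ) * (1 / ((m : ℚ) * ((m : ℚ) - 1))) := by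
          refine Finset.sum_le_sum_of_subset_of_nonneg hP fun m hm _ => ?_
          have h2 := hm2 m hm
          have : (0 : ℚ) < (m : ℚ) * ((m : ℚ) - 1) := by nlinarith
          positivity
      _ = (K : ℚ) * ∑ m ∈ Finset.Icc p₀ S, 1 / ((m : ℚ) * ((m : ℚ) - 1)) := by
          rw [Finset.mul_sum]
      _ ≤ (K : ℚ) * (1 / ((p₀ : ℚ) - 1)) :=
          mul_le_mul_of_nonneg_left (apSieve_sum_le p₀ S hp₀) (by positivity)
      _ = (K : ℚ) / ((p₀ : ℚ) - 1) := by ring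
  have h2 : (((p₀ - 1) * ∑ m ∈ P, K / (m * m) : ℕ) : ℚ) ≤ (K : ℚ) := by
    rw [Nat.cast_mul, Nat.cast_sub (by omega : 1 ≤ p₀), Nat.cast_one]
    have hp1 : (p₀ : ℚ) - 1 ≠ 0 := by linarith
    calc ((p₀ : ℚ) - 1) * ((∑ m ∈ P, K / (m * m) : ℕ) : ℚ)
        ≤ ((p₀ : ℚ) - 1) * ((K : ℚ) / ((p₀ : ℚ) - 1)) :=
          mul_le_mul_of_nonneg_left key (by linarith)
      _ = K := by field_simp
  exact_mod_cast h2

/-- **STUB S · `stub_apSieve`**: the elementary squarefree sieve in an arithmetic progression.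
If `0 < q`, `gcd(a, q) = 1`, `2 ≤ p₀` and every prime not dividing `q` is `≥ p₀`, then
`(p₀ - 1) · #{k < K : ¬ Squarefree (a + q k)} ≤ K + (p₀ - 1) · Nat.sqrt (a + q K)`. -/
theorem stub_apSieve :
    ∀ (a q K p₀ : ℕ), 0 < q → Nat.Coprime a q → 2 ≤ p₀ →
      (∀ p : ℕ, p.Prime → ¬ p ∣ q → p₀ ≤ p) →
        (p₀ - 1) * ((Finset.range K).filter (fun k => ¬ Squarefree (a + q * k))).card ≤
          K + (p₀ - 1) * Nat.sqrt (a + q * K) := by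
  intro a q K p₀ _hq haq hp₀ hprime
  rcases Nat.eq_zero_or_pos a with ha | ha
  · -- `a = 0`: then `q = 1`, `p₀ = 2`, and the bound is the trivial `#bad ≤ K`.
    subst ha
    have hq1 : q = 1 := (Nat.coprime_zero_left q).mp haq
    subst hq1
    have h2 : p₀ ≤ 2 := hprime 2 Nat.prime_two (by omega)
    have hp : p₀ = 2 := le_antisymm h2 hp₀
    subst hp
    have h := Finset.card_filter_le (Finset.range K) (fun k => ¬ Squarefree (0 + 1 * k))
    rw [Finset.card_range] at h
    omega
  · -- `a ≥ 1`: the sieve.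
    set S := Nat.sqrt (a + q * K) with hS
    set P := (Finset.Icc p₀ S).filter (fun m => Nat.Coprime m q) with hP
    have hcover : (Finset.range K).filter (fun k => ¬ Squarefree (a + q * k)) ⊆
        P.biUnion (fun m => (Finset.range K).filter (fun k => m * m ∣ a + q * k)) := by
      intro k hk
      rw [Finset.mem_filter, Finset.mem_range] at hk
      obtain ⟨hkK, hnsq⟩ := hk
      rw [Nat.squarefree_iff_prime_squarefree] at hnsq
      push Not at hnsq
      obtain ⟨p, hp, hpdvd⟩ := hnsq
      have hpq : ¬ p ∣ q := by
        intro hpq'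
        have h1 : p ∣ a + q * k := dvd_trans (dvd_mul_right p p) hpdvd
        have h2 : p ∣ q * k := dvd_mul_of_dvd_left hpq' k
        have h3 : p ∣ a := (Nat.dvd_add_left h2).mp h1
        have h4 : p ∣ Nat.gcd a q := Nat.dvd_gcd h3 hpq'
        rw [Nat.Coprime.gcd_eq_one haq] at h4
        exact hp.one_lt.ne' (Nat.dvd_one.mp h4)
      have hp₀p : p₀ ≤ p := hprime p hp hpq
      have hle : p * p ≤ a + q * K := by
        have h1 := Nat.le_of_dvd (by omega) hpdvd
        have h2 : q * k ≤ q * K := Nat.mul_le_mul_left q hkK.le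
        omega
      have hpS : p ≤ S := Nat.le_sqrt.mpr hle
      rw [Finset.mem_biUnion]
      refine ⟨p, ?_, ?_⟩
      · rw [hP, Finset.mem_filter, Finset.mem_Icc]
        exact ⟨⟨hp₀p, hpS⟩, (Nat.Prime.coprime_iff_not_dvd hp).mpr hpq⟩
      · rw [Finset.mem_filter, Finset.mem_range]
        exact ⟨hkK, hpdvd⟩
    have hB : ∀ m ∈ P,
        ((Finset.range K).filter (fun k => m * m ∣ a + q * k)).card ≤ K / (m * m) + 1 := by
      intro m hm
      rw [hP, Finset.mem_filter] at hm
      exact apSieve_card_filter_dvd_le a q K (m * m) (Nat.Coprime.mul_left hm.2 hm.2)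
    have hcard : ((Finset.range K).filter (fun k => ¬ Squarefree (a + q * k))).card ≤
        ∑ m ∈ P, (K / (m * m) + 1) :=
      calc ((Finset.range K).filter (fun k => ¬ Squarefree (a + q * k))).card
          ≤ (P.biUnion (fun m => (Finset.range K).filter (fun k => m * m ∣ a + q * k))).card :=
            Finset.card_le_card hcover
        _ ≤ ∑ m ∈ P, ((Finset.range K).filter (fun k => m * m ∣ a + q * k)).card :=
            Finset.card_biUnion_le
        _ ≤ ∑ m ∈ P, (K / (m * m) + 1) := Finset.sum_le_sum hB
    have hPcard : P.card ≤ S :=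
      calc P.card ≤ (Finset.Icc p₀ S).card := Finset.card_filter_le _ _
        _ = S + 1 - p₀ := Nat.card_Icc _ _
        _ ≤ S := by omega
    have hsum : (p₀ - 1) * ∑ m ∈ P, K / (m * m) ≤ K :=
      apSieve_mul_sum_div_le p₀ S K hp₀ P (Finset.filter_subset _ _)
    have hPc := Nat.mul_le_mul_left (p₀ - 1) hPcard
    calc (p₀ - 1) * ((Finset.range K).filter (fun k => ¬ Squarefree (a + q * k))).card
        ≤ (p₀ - 1) * ∑ m ∈ P, (K / (m * m) + 1) := Nat.mul_le_mul_left _ hcard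
      _ = (p₀ - 1) * ∑ m ∈ P, K / (m * m) + (p₀ - 1) * P.card := by
          rw [Finset.sum_add_distrib, Finset.sum_const, smul_eq_mul, mul_one, Nat.mul_add]
      _ ≤ K + (p₀ - 1) * S := Nat.add_le_add hsum hPc

end Summit.QuantumAdvantage.QuantumAdvantage.Theorems.IqThreeNotPPoly
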